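import Literature.AlgebraicGeometry.Frobenioids.MotivatingExamplesSubSplitPrimes
import Literature.AlgebraicGeometry.Frobenioids.MotivatingExamplesSubProofs
import HarnessLib

/-!
# Frobenioids I, Theorem 6.4 (iv), sub-node T64iv/L07a: the field isomorphism `L₁ ≅ L₂` — DISCHARGED

Mochizuki, *The geometry of Frobenioids I: the general theory*, Kyushu J. Math. **62** (2008) 293–400,
Thm. 6.4 (iv) p. 115 l. 23–29 and its proof p. 116 l. 27–35 [cite: MochizukiFrdI2008, Thm. 6.4 (iv) p.115]:

> "Note that this [`deg(Ψ^rlf) = 1`] implies that `v₁` is of degree 1 … if and only if `v₂` is of degree 1.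
> Thus, if `L₁` is Galois over `ℚ`, then whenever `v₂` is of degree 1, it follows that `v₁` is of degree 1,
> hence that `p` splits completely in `L₁` [since `L₁` is Galois over `ℚ`]. But this implies [again by
> Tchebotarev's density theorem — cf., e.g., [NSW], Theorem 12.2.5] that `L₁ ⊆ L₂`, hence that `L₁ = L₂`
> [since we have already seen that `[L₁ : ℚ] = [L₂ : ℚ]`]. This completes the proof of assertion (iv)."

PROOF-ONLY companion (seat abc-iut-w4-d109; row T64iv/L07a of `plan/L1/SUBDAG-FrdI-Thm64.md`, split off
T64iv/L07 by L1-lead R78 (11) / the typer abc-iut-L1-t3 (T64iv-Q1): L07a = WHAT THE PRINTED PROOF PROVES,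
`Nonempty (X.L ≃+* (ΨBase.obj X).L)`; the `F`-compatibility clause L07b of abc-iut-L1-t3's schema `Thm64iv`
is asserted in print's statement but not argued in print's proof — GAP-LEDGER G-L1t3-1, not touched here).
Over abc-iut-L1-t1's sub-DAG vocabulary (`MotivatingExamplesSub.lean`: `residueChar`, `placesOver`,
`SplitsCompletely`, `logNorm`) and the landed rows T64iv/L04 (`Thm64iv_L04_degreeEq_holds`), T64iv/L06
(Bauer in the degree-one form, `Thm64iv_L06_Bauer_holds`, abc-iut-L1-t3) and T64iv/L07
(`Thm64iv_L07_isoOfDegreeEq_holds`, abc-iut-L1-t1), plus the tree's "finitely many ramified primes" and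
"below an unramified degree-one place of a Galois field the prime splits completely"
(`Literature.NumberTheory.NumberFields.finite_setOf_not_isUnramifiedAt`,
`Literature.NumberTheory.GaloisRepresentations.splitsCompletely_absNorm_of_prime_absNorm`):
* `splitsCompletely_residueChar_of_isGalois` — the step "[since `L₁` is Galois over `ℚ`]": below a
  degree-one place, unramified over `ℚ`, of a Galois number field the residue characteristic splits completely
  (print omits the finitely many ramified primes; Bauer's theorem tolerates a finite exceptional set);
* `nonempty_ringHom_of_isGalois_of_degreeOne_transport` — "`L₁ ⊆ L₂`": from a residue-characteristic
  preserving bijection of finite places `π` (Thm. 6.4 (iii)) along which degree-one places of `L₂` come from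
  degree-one places of `L₁`, with `L₁/ℚ` Galois;
* `nonempty_ringEquiv_of_isGalois_of_degreeOne_transport` — **T64iv/L07a**: "hence `L₁ = L₂`" (degrees
  agree by T64iv/L04, then T64iv/L07);
* `nonempty_ringEquiv_of_isGalois_of_logNorm_transport` — the same from the `δ`-relation with `deg(Ψ^rlf) = 1`
  ("generator ↦ generator": `log N(v₁) = log N(v₂)`), which yields the degree-one transport;
* `Thm64iv_fieldIso_of_transport` — the row in the letter of abc-iut-L1-t3's schema: for
  `X : FinSubextCat F₁ K₁` with `X.L` Galois over `ℚ` and `ΨBase : D₁ ⥤ D₂`, `Nonempty (X.L ≃+* (ΨBase.obj X).L)`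
  from the transported data at `X`.
No new definitions, no named facts; classical algebraic number theory read through the sub-DAG's vocabulary;
nothing here bears on, or takes a side on, [IUTchIII] Cor. 3.12.
-/

noncomputable section

namespace Literature.AlgebraicGeometry.Frobenioids

open CategoryTheory NumberField IsDedekindDomain Ideal
open Literature.NumberTheory Literature.NumberTheory.NumberFields

/-! ### "[since `L₁` is Galois over `ℚ`]": a degree-one place forces complete splitting -/

section Galois

variable {L : Type} [Field L] [NumberField L]

/-- A finite place of degree one (`N(𝔭_w) = p`, `p` the residue characteristic) has prime absolute norm.
[cite: MochizukiFrdI2008, Thm. 6.4 (iv) p.116] -/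
theorem absNorm_prime_of_eq_residueChar (w : FinitePlace L)
    (hw : absNorm w.maximalIdeal.asIdeal = residueChar w) : (absNorm w.maximalIdeal.asIdeal).Prime := by
  rw [hw]
  exact residueChar_prime w

/-- Conversely a place of prime absolute norm `p` has residue characteristic `p` (is of degree one).
[cite: MochizukiFrdI2008, Thm. 6.4 (iv) p.116] -/
theorem residueChar_eq_of_absNorm_prime (w : FinitePlace L) {p : ℕ} (hp : p.Prime)
    (hw : absNorm w.maximalIdeal.asIdeal = p) : residueChar w = p := by
  unfold residueChar
  rw [hw, hp.minFac_eq]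

/-- **"whenever `v` is of degree 1 … `p` splits completely in `L` [since `L` is Galois over `ℚ`]"** (p. 116
l. 30–31), with the tacit proviso that `p` be unramified in `L`: below a degree-one finite place `w` of a number
field `L` Galois over `ℚ` whose prime is unramified over `ℤ`, the residue characteristic of `w` splits completely
in `L` (all places above it are conjugate to `w`). [cite: MochizukiFrdI2008, Thm. 6.4 (iv) p.116] -/
theorem splitsCompletely_residueChar_of_isGalois [IsGalois ℚ L] (w : FinitePlace L)
    (hw : absNorm w.maximalIdeal.asIdeal = residueChar w)
    (hunr : Algebra.IsUnramifiedAt ℤ w.maximalIdeal.asIdeal) : SplitsCompletely L (residueChar w) := by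
  have hprime := absNorm_prime_of_eq_residueChar w hw
  have h := GaloisRepresentations.splitsCompletely_absNorm_of_prime_absNorm (M := L) (E := L)
    w.maximalIdeal hprime hunr
  rw [hw] at h
  exact (splitsCompletely_iff_prime_and (residueChar w)).mpr ⟨residueChar_prime w, h⟩

variable (L) in
/-- **The finitely many exceptional primes**: the residue characteristics of the ramified places of `L` form a
finite set of rational primes (only finitely many primes of `𝓞 L` are ramified over `ℤ`); outside it every
place is unramified. [cite: MochizukiFrdI2008, Thm. 6.4 (iv) p.116] -/
theorem exists_finset_isUnramifiedAt_of_residueChar_not_mem :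
    ∃ S : Finset ℕ, ∀ w : FinitePlace L, residueChar w ∉ S → Algebra.IsUnramifiedAt ℤ w.maximalIdeal.asIdeal := by
  classical
  have hfin := finite_setOf_not_isUnramifiedAt (K := L)
  refine ⟨hfin.toFinset.image fun v => (absNorm v.asIdeal).minFac, fun w hw => ?_⟩
  by_contra hram
  apply hw
  rw [Finset.mem_image]
  exact ⟨w.maximalIdeal, hfin.mem_toFinset.mpr hram, rfl⟩

end Galois

/-! ### T64iv/L07a: `L₁ ⊆ L₂`, hence `L₁ = L₂` -/

section FieldIso

variable (L₁ : Type) [Field L₁] [NumberField L₁] (L₂ : Type) [Field L₂] [NumberField L₂]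

/-- **"But this implies [[NSW], Theorem 12.2.5] that `L₁ ⊆ L₂`"** (p. 116 l. 31–33): let `L₁/ℚ` be Galois and
`π : 𝕍(L₁)^non ≃ 𝕍(L₂)^non` a bijection of finite places preserving residue characteristics (Thm. 6.4 (iii))
along which every degree-one place of `L₂` comes from a degree-one place of `L₁` ("whenever `v₂` is of degree
1, it follows that `v₁` is of degree 1"). Then `L₁` embeds into `L₂`: off the finitely many primes ramified in
`L₁`, every rational prime with a degree-one place in `L₂` splits completely in `L₁`, and Bauer's theorem
(T64iv/L06) applies. [cite: MochizukiFrdI2008, Thm. 6.4 (iv) p.116] -/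
theorem nonempty_ringHom_of_isGalois_of_degreeOne_transport [IsGalois ℚ L₁]
    (π : FinitePlace L₁ ≃ FinitePlace L₂) (hπ : ∀ w, residueChar (π w) = residueChar w)
    (hdeg : ∀ w : FinitePlace L₁, absNorm (π w).maximalIdeal.asIdeal = residueChar (π w) →
      absNorm w.maximalIdeal.asIdeal = residueChar w) :
    Nonempty (L₁ →+* L₂) := by
  obtain ⟨S, hS⟩ := exists_finset_isUnramifiedAt_of_residueChar_not_mem L₁
  refine Thm64iv_L06_Bauer_holds L₁ L₂ inferInstance S fun p hp hpS hw₂ => ?_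
  obtain ⟨w₂, hw₂⟩ := hw₂
  -- the place `v₁ := π⁻¹ v₂` of `L₁` below which `p` lies
  set w₁ : FinitePlace L₁ := π.symm w₂ with hw₁
  have hπw : π w₁ = w₂ := π.apply_symm_apply w₂
  have hrc₂ : residueChar w₂ = p := residueChar_eq_of_absNorm_prime w₂ hp hw₂
  have hrc₁ : residueChar w₁ = p := by rw [← hπ w₁, hπw, hrc₂]
  -- `v₂` is of degree one, hence so is `v₁`
  have hdeg₁ : absNorm w₁.maximalIdeal.asIdeal = residueChar w₁ :=
    hdeg w₁ (by rw [hπw, hw₂, hrc₂])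
  -- `p ∉ S`: `v₁` is unramified over `ℤ`, so `p` splits completely in the Galois `L₁`
  have hunr : Algebra.IsUnramifiedAt ℤ w₁.maximalIdeal.asIdeal := hS w₁ (hrc₁ ▸ hpS)
  rw [← hrc₁]
  exact splitsCompletely_residueChar_of_isGalois w₁ hdeg₁ hunr

/-- **T64iv/L07a — "hence that `L₁ = L₂` [since we have already seen that `[L₁ : ℚ] = [L₂ : ℚ]`]"** (p. 116
l. 33–35): under the hypotheses of `nonempty_ringHom_of_isGalois_of_degreeOne_transport`, `L₁ ≅ L₂` as fields —
the embedding of Bauer's theorem is an isomorphism because a residue-characteristic preserving bijection of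
finite places forces `[L₁ : ℚ] = [L₂ : ℚ]` (T64iv/L04, via a completely split prime, T64iv/L03) and an embedding
of number fields of equal degree is an isomorphism (T64iv/L07). [cite: MochizukiFrdI2008, Thm. 6.4 (iv) p.116] -/
theorem nonempty_ringEquiv_of_isGalois_of_degreeOne_transport [IsGalois ℚ L₁]
    (π : FinitePlace L₁ ≃ FinitePlace L₂) (hπ : ∀ w, residueChar (π w) = residueChar w)
    (hdeg : ∀ w : FinitePlace L₁, absNorm (π w).maximalIdeal.asIdeal = residueChar (π w) →
      absNorm w.maximalIdeal.asIdeal = residueChar w) :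
    Nonempty (L₁ ≃+* L₂) :=
  Thm64iv_L07_isoOfDegreeEq_holds L₁ L₂
    (nonempty_ringHom_of_isGalois_of_degreeOne_transport L₁ L₂ π hπ hdeg)
    (Thm64iv_L04_degreeEq_holds L₁ L₂ π hπ).2.1

/-- Along the `δ`-relation with `deg(Ψ^rlf) = 1` — "`deg^arith_{L_i}` maps a generator of `Φ_i(L_i)_{v_i}` to
`log N(v_i)`" and generator goes to generator, so `log N(v₁) = log N(v₂)` — the absolute norms of corresponding
places agree. [cite: MochizukiFrdI2008, Thm. 6.4 (iv) p.116] -/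
theorem absNorm_eq_of_logNorm_eq {w₁ : FinitePlace L₁} {w₂ : FinitePlace L₂} (h : logNorm w₁ = logNorm w₂) :
    absNorm w₁.maximalIdeal.asIdeal = absNorm w₂.maximalIdeal.asIdeal := by
  simp only [logNorm] at h
  have h₁ : (0 : ℝ) < (absNorm w₁.maximalIdeal.asIdeal : ℝ) := by
    exact_mod_cast Nat.lt_of_lt_of_le zero_lt_one
      (NumberField.HeightOneSpectrum.one_lt_absNorm w₁.maximalIdeal).le
  have h₂ : (0 : ℝ) < (absNorm w₂.maximalIdeal.asIdeal : ℝ) := by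
    exact_mod_cast Nat.lt_of_lt_of_le zero_lt_one
      (NumberField.HeightOneSpectrum.one_lt_absNorm w₂.maximalIdeal).le
  exact_mod_cast Real.log_injOn_pos (Set.mem_Ioi.mpr h₁) (Set.mem_Ioi.mpr h₂) h

/-- **T64iv/L07a from the transports of the Frobenioid-theoretic part** (p. 116 l. 27–35): if `L₁/ℚ` is Galois
and `Ψ` induces a residue-characteristic preserving bijection `π` of finite places (Thm. 6.4 (iii)) along which,
`deg(Ψ^rlf)` being `1` (first clause of (iv)), the `δ`-relation reads `log N(v₁) = log N(π v₁)` (generator ↦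
generator, T64iv/L01), then `L₁ ≅ L₂`. [cite: MochizukiFrdI2008, Thm. 6.4 (iv) p.116] -/
theorem nonempty_ringEquiv_of_isGalois_of_logNorm_transport [IsGalois ℚ L₁]
    (π : FinitePlace L₁ ≃ FinitePlace L₂) (hπ : ∀ w, residueChar (π w) = residueChar w)
    (hgen : ∀ w, logNorm w = logNorm (π w)) : Nonempty (L₁ ≃+* L₂) :=
  nonempty_ringEquiv_of_isGalois_of_degreeOne_transport L₁ L₂ π hπ fun w hw => by
    rw [absNorm_eq_of_logNorm_eq L₁ L₂ (hgen w), hw, hπ w]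

end FieldIso

/-! ### The row in the letter of the schema `Thm64iv`: `Nonempty (X.L ≃+* (ΨBase.obj X).L)` -/

section Schema

variable {F₁ : Type} [Field F₁] [NumberField F₁] {K₁ : Type} [Field K₁] [Algebra F₁ K₁]
variable {F₂ : Type} [Field F₂] [NumberField F₂] {K₂ : Type} [Field K₂] [Algebra F₂ K₂]

/-- **Thm. 6.4 (iv), second clause, the part its printed proof establishes (T64iv/L07a)**: for the base
categories `D_i = {Spec L : F_i ⊆ L ⊆ F̃_i finite}` of two arithmetic Frobenioids, a functor `Ψ^Base : D₁ ⥤ D₂`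
(Cor. 4.11 (ii)), and `X = Spec L₁` with `L₁` Galois over `ℚ`, write `L₂` for the field of `Ψ^Base(X)`; if the
bijection of finite places `𝕍(L₁)^non ≃ 𝕍(L₂)^non` induced by `Ψ` (Thm. 6.4 (iii), Cor. 4.11 (iii)) preserves
residue characteristics and, `deg(Ψ^rlf)` being `1`, the norms (`log N(v₁) = log N(v₂)`), then `L₂ ≅ L₁` as
fields. (The compatibility with an isomorphism `F₁ ≅ F₂` asserted in print is row T64iv/L07b, not argued in the
printed proof and not claimed here.) [cite: MochizukiFrdI2008, Thm. 6.4 (iv) p.115] -/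
theorem Thm64iv_fieldIso_of_transport (ΨBase : FinSubextCat F₁ K₁ ⥤ FinSubextCat F₂ K₂)
    (X : FinSubextCat F₁ K₁) (hX : IsGalois ℚ X.L)
    (π : FinitePlace X.L ≃ FinitePlace (ΨBase.obj X).L) (hπ : ∀ w, residueChar (π w) = residueChar w)
    (hgen : ∀ w, logNorm w = logNorm (π w)) : Nonempty (X.L ≃+* (ΨBase.obj X).L) := by
  haveI := hX
  exact nonempty_ringEquiv_of_isGalois_of_logNorm_transport X.L (ΨBase.obj X).L π hπ hgen

end Schema

end Literature.AlgebraicGeometry.Frobenioids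

end
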